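import Summits.QuantumFields.BalabanUV.Beta.GAN24.T2RecHybridSplit
import Summits.QuantumFields.BalabanUV.Beta.GAN24.Push4Iter

/-!
# `BalabanUV.Beta.GAN24.T2DeviationTower` — binder row G-an2-4 ∕ (CONV-C), CT-W, RULING R-gan24p1-g23-1 (route (R-DEV), `gen23/F2-NUMERIC-v0.md` §4):
# **THE DEVIATION TOWER `D_j := T̃_j − T_j` OF THE DRESSED T₂ TOWER FROM A REFERENCE-KERNEL TOWER WITH THE SAME SOURCES — its affine recursion, its unrolled form,
# the comb instance (reference kernel = the UNDRESSED `KInvStep`), the generic shape socket, and «T2Shape» of the comb tower from four displayed rows**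
# (row owner b2b-balaban-gan24-p1, gen 23)

NOT IN PRINT; OUR PROOF ATTEMPT.  HONEST FRAMING (cell contract, verbatim): «discharging `BetaPertH` makes Bałaban's UV stability UNCONDITIONAL — a real
constructive-QFT result; it is NOT the continuum limit and NOT the Clay problem.»  HONEST DEPENDENCY (verbatim): «continuum YM on T⁴ ⇐ BetaPertH ∧ nine spine
estimates (0/9 proved); BetaPertH ⇐ (D1) ∧ (D4) ∧ CAP+tail; G-an2-4 gates asym, D1 and NE2/3/4.»

WHY (the owner's numeric twin of the (F2) first test, D = 2, `F2-NUMERIC-v0.md`): the T-free dressed source `b̃_0` of the (R-HYB) split CARRIES cell charge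
(`zmode (b̃_0) = −8·zmode (𝒜^B_0 T_0) ≠ 0`), while the dressed member carries EXACTLY the undressed member's charge (`zmode (T̃_1) = zmode (T_1)`).  So the
object to transport is not the T-free source but the DEVIATION of the dressed tower from the tower with the UNDRESSED kernel in the `lin4`∕`K3OfK`∕`W2SymOfK` slot and
the SAME sources: `D_{j+1} = 𝒜^G_j D_j + g_j`, `g_j := (𝒜^G_j − 𝒜^K_j) T^K_j + (b^G_j − b^K_j)` — a forcing on the REFERENCE tower only.
WHAT ([folklore] algebra over leaf-01's `AffineUnroll` and p2 g35's (F1) `T2RecOfUnitSplit`; 0 `def`, 0 cited facts, 0 `def … : Prop`, 0 sorry):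
* §1 `shape_of_dev_rows` — THE GENERIC SOCKET (generic `d`): if `T′ n = T n + Σ_{i<n} 𝒯^A(i+1, n−1−i) (g i)`, the reference tower `T` is uniformly `LocStencil₂`,
  the forcings `g i` are uniformly `LocStencil₂`, zero-mode-free (`Zfree`, abstract) with first moment `mom ≤ Cg`, and the transport `𝒯^A` is IRRELEVANT on such
  tables (gain `ρ^k`, the shape of road W3's row F3b `hTirr` — for the DRESSED transport this is CT-W's crux (F3ᴱ-irr), a HYPOTHESIS here), then `T′` is uniformly
  `LocStencil₂` (constant `C₂ + Cᴱ·Cg·(1−ρ)⁻¹`, rate `min δ₂ δᴱ`);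
* §2 `unitS₂_T2RecOf_dev_succ_of_letters` (the deviation's affine step `T^G_{j+1} − T^K_{j+1} = 𝒜^G_j (T^G_j − T^K_j) + g_j`) and
  **`unitS₂_T2RecOf_dev_eq_sum_of_letters`** — SLOTTED, generic `d`, ANY two kernel families `G K` with an2's letters (DG) for both, (LS)(LM), the border's
  off-diagonality ∕ shape and the mixed-table letter: `T^G_n = T^K_n + Σ_{i<n} 𝒯^G(i+1, n−1−i) g_i` with `g_i` DISPLAYED
  (`= (lin4 c₄ G̃_i Lc T^K_i − lin4 c₄ K̃_i Lc T^K_i) + (b^G_i − b^K_i)`, `b^F_i` = the T-free source of (F1) at the kernel `F`); proof = the two affine steps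
  (`unitS₂_T2RecOf_succ_eq_lin4_add`) + `lin4` additivity on bounded tables (`lin4_add_of_bdd₄`) + `AffineUnroll.eq_transport_add_sum` on the class of bounded
  bi-tables + `transport_map_zero` (`D_0 = 0`: both members 0 are `cE₂ • wilsonW₂ + cB • vh₂S`);
* §3 **`unitS₂_T2RecAt_dev_eq_sum`** — THE COMB INSTANCE (generic `d`, in-block root `r`, an1's `mixFFAt (toSite r) Lc`): `G_j = coDressKBmAt ρ Lc (KInvStep Lc j)` (an2's
  comb tower `T2RecAt`, by `T2RecOf_comb`), `K_j = KInvStep Lc j` (the UNDRESSED-KERNEL comb-slot tower); letters discharged as in p2's `T2RecHybridSplit` §4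
  (asym1's `decays_coDressKBmAt_KInvStep`, `OneStepKernelFamily.decays_KInvStep`, an2's `locStencil_SpureRecAt` ∕ `vertexFamily_M1At`, an1's `hmix_an1`);
* §4 **`t2Shape_T2RecAt_of_dev_rows`** — THE (R-DEV) END (generic `d`): «T2Shape» of the comb T₂ tower ⟸ (U) «T2Shape» of the undressed-kernel comb-slot tower ∧
  (G′) a uniform `LocStencil₂` row of the forcings `g′_j` ∧ (Z′) `Zfree (g′_j)` ∧ `mom (g′_j) ≤ Cg` ∧ (F3ᴱ-irr) irrelevance of the DRESSED transport on `Zfree` tables —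
  every row DISPLAYED (`Zfree`, `mom` ABSTRACT — the invariant class of the DRESSED transport is (F3ᴱ-irr)'s author's to choose: road W3's `ZfreeSym` is the class of the
  UNDRESSED transport; by leaf-02 g52 ∕ leaf-06 g43 ∕ p2 g36 (journal l.37992 ∕ l.38056 ∕ l.38072) a dressed step reads the FOUR-FACE charge of its input, and the owner's
  numbers (`gen23/F2-NUMERIC-v0.md` + addendum (T1)) show a charge-free table with non-zero four-face charge at level 1 — so `ZfreeSym` alone is NOT expected to be that class).
NOT HERE: the rows.  (U) = road W3's sockets (`TransportRows`) + p2's `T2RecSourceRows.source_shape_of_rows` at `G := KInvStep` + an F2a for the comb sources; (Z′) = the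
Ward identity behind `zmode (T̃_1) = zmode (T_1)` (an2's table laws ∀ j); (G′) by name over (U) + leaf-06's `LinT2CoDressed.locStencil₂_dress ∕ _coProj_*`; (F3ᴱ-irr) =
CT-W's crux (the dressed twin of leaf-12's ROW W3-F3b; mechanism = leaf-06 ∕ leaf-02's `(𝔇 − 1)`-defects).  Discharges NOTHING of «T2Shape» ∕ «T2Drift» ∕ (hW, hWall);
NEVER «G-an2-4 closed» as (CONV-C); NOT D1, NOT `BetaPertH`, NOT continuum, NOT Clay.  2026-08-22.
-/

noncomputable section

open Finset
open scoped BigOperators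
open Literature.MathematicalPhysics.QuantumFieldTheory
open Literature.MathematicalPhysics.QuantumFieldTheory.Balaban1983to89
open Literature.MathematicalPhysics.QuantumFieldTheory.Balaban1983to89.Beta
open ExpKernelCalculus (MKer Decays VertexFamily VertexFamily₂)
open OneStepResolventKernel (Fib LocStencil)
open OneStepKernelFamily (KInvStep decays_KInvStep)
open AffineAveraging (box toSite)
open AveragingMixedJetTables (mixFFAt)
open SecondOrderResponse (W2SymOfK LocStencilFM)
open BalabanCompositeJets (LocStencil₂ LocStencil₂.nonneg LocStencil₂.mono)
open BalabanStepJetsSucc (mmRead)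
open BalabanStepW2 (K3OfK M2Of)
open Summit.QuantumFields.BalabanUV.Beta.HessKerDressedUnits (unitK unitS decays_unitK)
open Summit.QuantumFields.BalabanUV.Beta.SecondOrderUnits (unitM unitS₂ unitM₂)
open Summit.QuantumFields.BalabanUV.Beta.AxialDressingRooted (coDressKBmAt decays_coDressKBmAt_KInvStep)
open Summit.QuantumFields.BalabanUV.Beta.SpineRooted (T2RecOf T2RecAt SpureRecAt M1At T2RecOf_comb T2RecOf_zero_level locStencil_SpureRecAt vertexFamily_M1At)
open Summit.QuantumFields.BalabanUV.Beta.MixedJetTablesPlug (hmix_an1)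
open Summit.QuantumFields.BalabanUV.Beta.GAN24.CombesThomas (sfStep smStep)
open Summit.QuantumFields.BalabanUV.Beta.GAN24.Push4Iter (BiTab)
open Summit.QuantumFields.BalabanUV.Beta.GAN24.T2RecursionAffine (lin4)
open Summit.QuantumFields.BalabanUV.Beta.GAN24.AffineUnroll
open Summit.QuantumFields.BalabanUV.Beta.GAN24.Lin4Additive (lin4_bdd lin4_add)
open Summit.QuantumFields.BalabanUV.Beta.GAN24.T2UnitSplitLevels (bdd₄_zero bdd₄_add bdd₄_sub lin4_add_of_bdd₄)
open Summit.QuantumFields.BalabanUV.Beta.GAN24.T2RecOfUnitSplit (unitS₂_T2RecOf_succ_eq_lin4_add step_data_of_letters bdd₄_unitS₂_T2RecOf_of_letters)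
open Summit.QuantumFields.BalabanUV.Beta.GAN24.T2RecHybridSplit (bdd₄_source_of_letters)
open Summit.QuantumFields.BalabanUV.Beta.GAN24.WSlotT2OfPieces (locStencil₂_add locStencil₂_mono locStencil₂_sum geom_reflect_sum_le)

namespace Summit.QuantumFields.BalabanUV.Beta.GAN24.T2DeviationTower

/-! ## §1 The generic socket: shape of a tower = reference tower + irrelevantly transported zero-mode-free forcings -/

section Socket

variable {d : ℕ}

/-- NOT IN PRINT; OUR BOOKKEEPING ([folklore] `locStencil₂_sum` + the geometric series, as in road W3's `WSlotT2OfPieces.shape_of_rows`; input rates merged by `min`).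
**SHAPE OF A DEVIATED TOWER**: if `T′ n = T n + Σ_{i<n} 𝒯^A(i+1, n−1−i) (g i)` with `T` uniformly `LocStencil₂ (C₂, δ₂)`, forcings `g i` uniformly `LocStencil₂ (Cg, δg)`,
zero-mode-free (`Zfree`) with `mom (g i) ≤ Cg`, and the transport `𝒯^A = AffineUnroll.transport A` IRRELEVANT on such tables (gain `ρ^k`, output rate `δᴱ`, uniformly in the
birth level), then `∀ n, LocStencil₂ (T′ n) (C₂ + Cᴱ·Cg·(1−ρ)⁻¹) (min δ₂ δᴱ)`. -/
theorem shape_of_dev_rows (T T' g : ℕ → BiTab d) (A : ℕ → BiTab d → BiTab d) (Zfree : BiTab d → Prop) (mom : BiTab d → ℝ)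
    {C₂ δ₂ Cg δg CE ρ δE : ℝ} (hCE : 0 ≤ CE) (hρ0 : 0 ≤ ρ) (hρ1 : ρ < 1)
    (hdev : ∀ n, T' n = T n + ∑ i ∈ Finset.range n, transport A (i + 1) (n - 1 - i) (g i))
    (hT : ∀ n, LocStencil₂ (T n) C₂ δ₂) (hg : ∀ m, LocStencil₂ (g m) Cg δg) (hZg : ∀ m, Zfree (g m)) (hmom : ∀ m, mom (g m) ≤ Cg)
    (hTirrE : ∀ (m k : ℕ) (X : BiTab d) (C : ℝ), 0 ≤ C → LocStencil₂ X C δg → Zfree X → mom X ≤ C →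
      LocStencil₂ (transport A m k X) (CE * C * ρ ^ k) δE) (n : ℕ) :
    LocStencil₂ (T' n) (C₂ + CE * Cg * (1 - ρ)⁻¹) (min δ₂ δE) := by
  have hCg : 0 ≤ Cg := (hg 0).nonneg
  rw [hdev n]
  refine locStencil₂_add ((hT n).mono (min_le_left _ _)) (locStencil₂_mono ((locStencil₂_sum (Finset.range n) _
    (fun i => CE * Cg * ρ ^ (n - 1 - i)) fun i _ => (hTirrE (i + 1) (n - 1 - i) (g i) Cg hCg (hg i) (hZg i) (hmom i)).mono (min_le_right _ _))) ?_)
  rw [← Finset.mul_sum]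
  exact mul_le_mul_of_nonneg_left (geom_reflect_sum_le hρ0 hρ1 n) (mul_nonneg hCE hCg)

end Socket

/-! ## §2 Slotted, generic `d`: the deviation of the `G`-tower from the `K`-tower, unrolled through the `G`-transport -/

section Slotted

variable {d : ℕ} {Lc : ℕ} [NeZero Lc] (G K : ℕ → MKer (d + 1) (Fib d)) (S : ℕ → Fin (d + 1) → (Fin (d + 1) → ℤ) → MKer (d + 1) (Fib d))
  (M : ℕ → Fin (d + 1) → (Fin (d + 1) → ℤ) → MKer (d + 1) (Fib d)) (cE₂ cB : ℝ) (Tc : Fin 4 → Fin 4 → Fin 4 → Fin 4 → ℝ)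
  (vh₂S mixFF : Fin (d + 1) → (Fin (d + 1) → ℤ) → Fin (d + 1) → (Fin (d + 1) → ℤ) → MKer (d + 1) (Fib d))

/-- NOT IN PRINT; OUR BOOKKEEPING ([folklore]).  **THE DEVIATION's AFFINE STEP — SLOTTED, MODULO an2's LETTERS**: with the notation of
`unitS₂_T2RecOf_dev_eq_sum_of_letters` below, `T^G_{j+1} − T^K_{j+1} = 𝒜^G_j (T^G_j − T^K_j) + g_j` (the two affine steps `unitS₂_T2RecOf_succ_eq_lin4_add`, and
`𝒜^G_j T^G_j = 𝒜^G_j (T^G_j − T^K_j) + 𝒜^G_j T^K_j` by `lin4_add_of_bdd₄` on bounded tables). -/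
theorem unitS₂_T2RecOf_dev_succ_of_letters (hLc : 1 ≤ Lc)
    (hBff : ∀ κ u κ' u' x z (α β : Fin (d + 1)), vh₂S κ u κ' u' x z (Sum.inl α) (Sum.inl β) = 0)
    (hBmm : ∀ κ u κ' u' x z (μ ν : Fin (d + 1)), vh₂S κ u κ' u' x z (Sum.inr μ) (Sum.inr ν) = 0)
    (hG : ∀ j : ℕ, ∃ δ C : ℝ, 0 < δ ∧ 0 ≤ C ∧ Decays (G j) C δ) (hK : ∀ j : ℕ, ∃ δ C : ℝ, 0 < δ ∧ 0 ≤ C ∧ Decays (K j) C δ)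
    (hS : ∀ j : ℕ, ∃ Cs δ : ℝ, 0 < δ ∧ LocStencil (S j) Cs δ) (hM : ∀ j : ℕ, ∃ CM δ : ℝ, 0 < δ ∧ VertexFamily (M j) Lc CM δ)
    (hB : ∃ C δ : ℝ, 0 < δ ∧ LocStencil₂ vh₂S C δ) (hmix : ∃ C δ : ℝ, 0 < δ ∧ LocStencilFM Lc mixFF C δ) (j : ℕ) :
    (unitS₂ (sfStep Lc (j + 1)) (smStep d Lc (j + 1)) (T2RecOf d Lc G S M cE₂ cB Tc vh₂S mixFF (j + 1))) - (unitS₂ (sfStep Lc (j + 1)) (smStep d Lc (j + 1)) (T2RecOf d Lc K S M cE₂ cB Tc vh₂S mixFF (j + 1))) =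
      (fun j => lin4 (cE₂ * (Lc : ℝ) ^ (2 * (d + 1))) (unitK (sfStep Lc j) (smStep d Lc j) (G j)) Lc) j ((unitS₂ (sfStep Lc j) (smStep d Lc j) (T2RecOf d Lc G S M cE₂ cB Tc vh₂S mixFF j)) - (unitS₂ (sfStep Lc j) (smStep d Lc j) (T2RecOf d Lc K S M cE₂ cB Tc vh₂S mixFF j))) +
      (((lin4 (cE₂ * (Lc : ℝ) ^ (2 * (d + 1))) (unitK (sfStep Lc j) (smStep d Lc j) (G j)) Lc
            (unitS₂ (sfStep Lc j) (smStep d Lc j) (T2RecOf d Lc K S M cE₂ cB Tc vh₂S mixFF j)) -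
          lin4 (cE₂ * (Lc : ℝ) ^ (2 * (d + 1))) (unitK (sfStep Lc j) (smStep d Lc j) (K j)) Lc
            (unitS₂ (sfStep Lc j) (smStep d Lc j) (T2RecOf d Lc K S M cE₂ cB Tc vh₂S mixFF j))) +
        ((fun κ u κ' u' => (cE₂ * (Lc : ℝ) ^ (2 * (d + 1))) • mmRead Lc (K3OfK (unitK (sfStep Lc j) (smStep d Lc j) (G j)) Lc
            (unitS (sfStep Lc j) (smStep d Lc j) (S j)) (unitM (sfStep Lc j) (smStep d Lc j) (M j))
            (W2SymOfK (unitK (sfStep Lc j) (smStep d Lc j) (G j)) Lc (unitS (sfStep Lc j) (smStep d Lc j) (S j))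
              (unitM (sfStep Lc j) (smStep d Lc j) (M j)) 0 (unitM₂ (sfStep Lc j) (smStep d Lc j) (M2Of d Lc mixFF j))) κ u κ' u')
          + cB • vh₂S κ u κ' u') -
         (fun κ u κ' u' => (cE₂ * (Lc : ℝ) ^ (2 * (d + 1))) • mmRead Lc (K3OfK (unitK (sfStep Lc j) (smStep d Lc j) (K j)) Lc
            (unitS (sfStep Lc j) (smStep d Lc j) (S j)) (unitM (sfStep Lc j) (smStep d Lc j) (M j))
            (W2SymOfK (unitK (sfStep Lc j) (smStep d Lc j) (K j)) Lc (unitS (sfStep Lc j) (smStep d Lc j) (S j))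
              (unitM (sfStep Lc j) (smStep d Lc j) (M j)) 0 (unitM₂ (sfStep Lc j) (smStep d Lc j) (M2Of d Lc mixFF j))) κ u κ' u')
          + cB • vh₂S κ u κ' u')))) := by
  have hbG : ∃ B : ℝ, ∀ κ u κ' u' x z a b, |(unitS₂ (sfStep Lc j) (smStep d Lc j) (T2RecOf d Lc G S M cE₂ cB Tc vh₂S mixFF j)) κ u κ' u' x z a b| ≤ B :=
    bdd₄_unitS₂_T2RecOf_of_letters G S M cE₂ cB Tc hLc hG hS hM hB hmix j
  have hbK : ∃ B : ℝ, ∀ κ u κ' u' x z a b, |(unitS₂ (sfStep Lc j) (smStep d Lc j) (T2RecOf d Lc K S M cE₂ cB Tc vh₂S mixFF j)) κ u κ' u' x z a b| ≤ B :=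
    bdd₄_unitS₂_T2RecOf_of_letters K S M cE₂ cB Tc hLc hK hS hM hB hmix j
  have hrecG : (unitS₂ (sfStep Lc (j + 1)) (smStep d Lc (j + 1)) (T2RecOf d Lc G S M cE₂ cB Tc vh₂S mixFF (j + 1))) =
      lin4 (cE₂ * (Lc : ℝ) ^ (2 * (d + 1))) (unitK (sfStep Lc j) (smStep d Lc j) (G j)) Lc (unitS₂ (sfStep Lc j) (smStep d Lc j) (T2RecOf d Lc G S M cE₂ cB Tc vh₂S mixFF j)) + (fun κ u κ' u' => (cE₂ * (Lc : ℝ) ^ (2 * (d + 1))) • mmRead Lc (K3OfK (unitK (sfStep Lc j) (smStep d Lc j) (G j)) Lc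
            (unitS (sfStep Lc j) (smStep d Lc j) (S j)) (unitM (sfStep Lc j) (smStep d Lc j) (M j))
            (W2SymOfK (unitK (sfStep Lc j) (smStep d Lc j) (G j)) Lc (unitS (sfStep Lc j) (smStep d Lc j) (S j))
              (unitM (sfStep Lc j) (smStep d Lc j) (M j)) 0 (unitM₂ (sfStep Lc j) (smStep d Lc j) (M2Of d Lc mixFF j))) κ u κ' u')
          + cB • vh₂S κ u κ' u') := by
    obtain ⟨C, δ, C₀, C₁, hδ, hKj, h₀, hW⟩ := step_data_of_letters G S M cE₂ cB Tc hLc hG hS hM hB hmix j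
    exact unitS₂_T2RecOf_succ_eq_lin4_add G S M cE₂ cB Tc vh₂S mixFF hBff hBmm j hδ hKj h₀ hW
  have hrecK : (unitS₂ (sfStep Lc (j + 1)) (smStep d Lc (j + 1)) (T2RecOf d Lc K S M cE₂ cB Tc vh₂S mixFF (j + 1))) =
      lin4 (cE₂ * (Lc : ℝ) ^ (2 * (d + 1))) (unitK (sfStep Lc j) (smStep d Lc j) (K j)) Lc (unitS₂ (sfStep Lc j) (smStep d Lc j) (T2RecOf d Lc K S M cE₂ cB Tc vh₂S mixFF j)) + (fun κ u κ' u' => (cE₂ * (Lc : ℝ) ^ (2 * (d + 1))) • mmRead Lc (K3OfK (unitK (sfStep Lc j) (smStep d Lc j) (K j)) Lc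
            (unitS (sfStep Lc j) (smStep d Lc j) (S j)) (unitM (sfStep Lc j) (smStep d Lc j) (M j))
            (W2SymOfK (unitK (sfStep Lc j) (smStep d Lc j) (K j)) Lc (unitS (sfStep Lc j) (smStep d Lc j) (S j))
              (unitM (sfStep Lc j) (smStep d Lc j) (M j)) 0 (unitM₂ (sfStep Lc j) (smStep d Lc j) (M2Of d Lc mixFF j))) κ u κ' u')
          + cB • vh₂S κ u κ' u') := by
    obtain ⟨C, δ, C₀, C₁, hδ, hKj, h₀, hW⟩ := step_data_of_letters K S M cE₂ cB Tc hLc hK hS hM hB hmix j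
    exact unitS₂_T2RecOf_succ_eq_lin4_add K S M cE₂ cB Tc vh₂S mixFF hBff hBmm j hδ hKj h₀ hW
  obtain ⟨δ, C, hδ, -, hGj⟩ := hG j
  have h := decays_unitK (sf := sfStep Lc j) (sm := smStep d Lc j) hGj
  have key : lin4 (cE₂ * (Lc : ℝ) ^ (2 * (d + 1))) (unitK (sfStep Lc j) (smStep d Lc j) (G j)) Lc (unitS₂ (sfStep Lc j) (smStep d Lc j) (T2RecOf d Lc G S M cE₂ cB Tc vh₂S mixFF j)) =
      lin4 (cE₂ * (Lc : ℝ) ^ (2 * (d + 1))) (unitK (sfStep Lc j) (smStep d Lc j) (G j)) Lc ((unitS₂ (sfStep Lc j) (smStep d Lc j) (T2RecOf d Lc G S M cE₂ cB Tc vh₂S mixFF j)) - (unitS₂ (sfStep Lc j) (smStep d Lc j) (T2RecOf d Lc K S M cE₂ cB Tc vh₂S mixFF j))) +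
        lin4 (cE₂ * (Lc : ℝ) ^ (2 * (d + 1))) (unitK (sfStep Lc j) (smStep d Lc j) (G j)) Lc (unitS₂ (sfStep Lc j) (smStep d Lc j) (T2RecOf d Lc K S M cE₂ cB Tc vh₂S mixFF j)) := by
    rw [← lin4_add_of_bdd₄ h hδ _ Lc (bdd₄_sub hbG hbK) hbK, sub_add_cancel]
  rw [hrecG, hrecK, key]
  simp only
  abel

/-- NOT IN PRINT; OUR BOOKKEEPING ([folklore]).  **THE DEVIATION TOWER UNROLLED — SLOTTED, MODULO an2's LETTERS** (generic `d`; kernel families `G` (e.g. dressed) and `K`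
(reference), the SAME sources `S M`, binder table `Tc`, border `vh₂S` ((ShB₂) `hBff`∕`hBmm`, shape `hB`), mixed table (`hmix`); (DG) for BOTH families, (LS), (LM)):
with `T^F_n := unitS₂_n (T2RecOf d Lc F S M cE₂ cB Tc vh₂S mixFF n)`, `𝒜^F_j := lin4 (cE₂·Lc^{2(d+1)}) (unitK_j (F j)) Lc`, `b^F_j` the T-free source of (F1) at `F`,
`T^G_n = T^K_n + Σ_{i<n} transport 𝒜^G (i+1) (n−1−i) g_i`, `g_i := (𝒜^G_i T^K_i − 𝒜^K_i T^K_i) + (b^G_i − b^K_i)`.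
Proof: `D_j := T^G_j − T^K_j` satisfies `D_{j+1} = 𝒜^G_j D_j + g_j` (the two affine steps `unitS₂_T2RecOf_succ_eq_lin4_add` and `lin4_add_of_bdd₄`), `D_0 = 0`
(`T2RecOf_zero_level`), and leaf-01's `eq_transport_add_sum` ∕ `transport_map_zero` on the class of bounded bi-tables. -/
theorem unitS₂_T2RecOf_dev_eq_sum_of_letters (hLc : 1 ≤ Lc)
    (hBff : ∀ κ u κ' u' x z (α β : Fin (d + 1)), vh₂S κ u κ' u' x z (Sum.inl α) (Sum.inl β) = 0)
    (hBmm : ∀ κ u κ' u' x z (μ ν : Fin (d + 1)), vh₂S κ u κ' u' x z (Sum.inr μ) (Sum.inr ν) = 0)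
    (hG : ∀ j : ℕ, ∃ δ C : ℝ, 0 < δ ∧ 0 ≤ C ∧ Decays (G j) C δ) (hK : ∀ j : ℕ, ∃ δ C : ℝ, 0 < δ ∧ 0 ≤ C ∧ Decays (K j) C δ)
    (hS : ∀ j : ℕ, ∃ Cs δ : ℝ, 0 < δ ∧ LocStencil (S j) Cs δ) (hM : ∀ j : ℕ, ∃ CM δ : ℝ, 0 < δ ∧ VertexFamily (M j) Lc CM δ)
    (hB : ∃ C δ : ℝ, 0 < δ ∧ LocStencil₂ vh₂S C δ) (hmix : ∃ C δ : ℝ, 0 < δ ∧ LocStencilFM Lc mixFF C δ) (n : ℕ) :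
    (unitS₂ (sfStep Lc n) (smStep d Lc n) (T2RecOf d Lc G S M cE₂ cB Tc vh₂S mixFF n)) =
      (unitS₂ (sfStep Lc n) (smStep d Lc n) (T2RecOf d Lc K S M cE₂ cB Tc vh₂S mixFF n)) +
      ∑ i ∈ Finset.range n, transport (fun j => lin4 (cE₂ * (Lc : ℝ) ^ (2 * (d + 1))) (unitK (sfStep Lc j) (smStep d Lc j) (G j)) Lc) (i + 1) (n - 1 - i)
        (((lin4 (cE₂ * (Lc : ℝ) ^ (2 * (d + 1))) (unitK (sfStep Lc i) (smStep d Lc i) (G i)) Lc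
            (unitS₂ (sfStep Lc i) (smStep d Lc i) (T2RecOf d Lc K S M cE₂ cB Tc vh₂S mixFF i)) -
          lin4 (cE₂ * (Lc : ℝ) ^ (2 * (d + 1))) (unitK (sfStep Lc i) (smStep d Lc i) (K i)) Lc
            (unitS₂ (sfStep Lc i) (smStep d Lc i) (T2RecOf d Lc K S M cE₂ cB Tc vh₂S mixFF i))) +
        ((fun κ u κ' u' => (cE₂ * (Lc : ℝ) ^ (2 * (d + 1))) • mmRead Lc (K3OfK (unitK (sfStep Lc i) (smStep d Lc i) (G i)) Lc
            (unitS (sfStep Lc i) (smStep d Lc i) (S i)) (unitM (sfStep Lc i) (smStep d Lc i) (M i))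
            (W2SymOfK (unitK (sfStep Lc i) (smStep d Lc i) (G i)) Lc (unitS (sfStep Lc i) (smStep d Lc i) (S i))
              (unitM (sfStep Lc i) (smStep d Lc i) (M i)) 0 (unitM₂ (sfStep Lc i) (smStep d Lc i) (M2Of d Lc mixFF i))) κ u κ' u')
          + cB • vh₂S κ u κ' u') -
         (fun κ u κ' u' => (cE₂ * (Lc : ℝ) ^ (2 * (d + 1))) • mmRead Lc (K3OfK (unitK (sfStep Lc i) (smStep d Lc i) (K i)) Lc
            (unitS (sfStep Lc i) (smStep d Lc i) (S i)) (unitM (sfStep Lc i) (smStep d Lc i) (M i))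
            (W2SymOfK (unitK (sfStep Lc i) (smStep d Lc i) (K i)) Lc (unitS (sfStep Lc i) (smStep d Lc i) (S i))
              (unitM (sfStep Lc i) (smStep d Lc i) (M i)) 0 (unitM₂ (sfStep Lc i) (smStep d Lc i) (M2Of d Lc mixFF i))) κ u κ' u')
          + cB • vh₂S κ u κ' u')))) := by
  -- decay data of the unit kernels (both families)
  have hGu : ∀ j, ∃ C δ : ℝ, 0 < δ ∧ Decays (unitK (sfStep Lc j) (smStep d Lc j) (G j)) C δ := fun j => by
    obtain ⟨δ, C, hδ, -, h⟩ := hG j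
    exact ⟨_, δ, hδ, decays_unitK (sf := sfStep Lc j) (sm := smStep d Lc j) h⟩
  have hKu : ∀ j, ∃ C δ : ℝ, 0 < δ ∧ Decays (unitK (sfStep Lc j) (smStep d Lc j) (K j)) C δ := fun j => by
    obtain ⟨δ, C, hδ, -, h⟩ := hK j
    exact ⟨_, δ, hδ, decays_unitK (sf := sfStep Lc j) (sm := smStep d Lc j) h⟩
  -- bounded entries of the members and of the sources (both families)
  have hbG : ∀ j, ∃ B : ℝ, ∀ κ u κ' u' x z a b, |(unitS₂ (sfStep Lc j) (smStep d Lc j) (T2RecOf d Lc G S M cE₂ cB Tc vh₂S mixFF j)) κ u κ' u' x z a b| ≤ B :=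
    fun j => bdd₄_unitS₂_T2RecOf_of_letters G S M cE₂ cB Tc hLc hG hS hM hB hmix j
  have hbK : ∀ j, ∃ B : ℝ, ∀ κ u κ' u' x z a b, |(unitS₂ (sfStep Lc j) (smStep d Lc j) (T2RecOf d Lc K S M cE₂ cB Tc vh₂S mixFF j)) κ u κ' u' x z a b| ≤ B :=
    fun j => bdd₄_unitS₂_T2RecOf_of_letters K S M cE₂ cB Tc hLc hK hS hM hB hmix j
  have hsG : ∀ j, ∃ B : ℝ, ∀ κ u κ' u' x z a b, |(fun κ u κ' u' => (cE₂ * (Lc : ℝ) ^ (2 * (d + 1))) • mmRead Lc (K3OfK (unitK (sfStep Lc j) (smStep d Lc j) (G j)) Lc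
            (unitS (sfStep Lc j) (smStep d Lc j) (S j)) (unitM (sfStep Lc j) (smStep d Lc j) (M j))
            (W2SymOfK (unitK (sfStep Lc j) (smStep d Lc j) (G j)) Lc (unitS (sfStep Lc j) (smStep d Lc j) (S j))
              (unitM (sfStep Lc j) (smStep d Lc j) (M j)) 0 (unitM₂ (sfStep Lc j) (smStep d Lc j) (M2Of d Lc mixFF j))) κ u κ' u')
          + cB • vh₂S κ u κ' u') κ u κ' u' x z a b| ≤ B :=
    fun j => bdd₄_source_of_letters (G := G) (S := S) (M := M) (cE₂ := cE₂) (cB := cB) (vh₂S := vh₂S) (mixFF := mixFF) Tc hLc hBff hBmm hG hS hM hB hmix j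
  have hsK : ∀ j, ∃ B : ℝ, ∀ κ u κ' u' x z a b, |(fun κ u κ' u' => (cE₂ * (Lc : ℝ) ^ (2 * (d + 1))) • mmRead Lc (K3OfK (unitK (sfStep Lc j) (smStep d Lc j) (K j)) Lc
            (unitS (sfStep Lc j) (smStep d Lc j) (S j)) (unitM (sfStep Lc j) (smStep d Lc j) (M j))
            (W2SymOfK (unitK (sfStep Lc j) (smStep d Lc j) (K j)) Lc (unitS (sfStep Lc j) (smStep d Lc j) (S j))
              (unitM (sfStep Lc j) (smStep d Lc j) (M j)) 0 (unitM₂ (sfStep Lc j) (smStep d Lc j) (M2Of d Lc mixFF j))) κ u κ' u')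
          + cB • vh₂S κ u κ' u') κ u κ' u' x z a b| ≤ B :=
    fun j => bdd₄_source_of_letters (G := K) (S := S) (M := M) (cE₂ := cE₂) (cB := cB) (vh₂S := vh₂S) (mixFF := mixFF) Tc hLc hBff hBmm hK hS hM hB hmix j
  -- the class of bounded bi-tables is preserved by the G-transport, which is additive on it
  have hAP : ∀ (j : ℕ) (X : BiTab d), (∃ B : ℝ, ∀ κ u κ' u' x z a b, |X κ u κ' u' x z a b| ≤ B) →
      ∃ B : ℝ, ∀ κ u κ' u' x z a b, |((fun j => lin4 (cE₂ * (Lc : ℝ) ^ (2 * (d + 1))) (unitK (sfStep Lc j) (smStep d Lc j) (G j)) Lc) j X) κ u κ' u' x z a b| ≤ B := fun j X hX => by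
    obtain ⟨C, δ, hδ, h⟩ := hGu j
    exact lin4_bdd h hδ _ Lc hX
  have hAadd : ∀ (j : ℕ) (X Y : BiTab d), (∃ B : ℝ, ∀ κ u κ' u' x z a b, |X κ u κ' u' x z a b| ≤ B) →
      (∃ B : ℝ, ∀ κ u κ' u' x z a b, |Y κ u κ' u' x z a b| ≤ B) → (fun j => lin4 (cE₂ * (Lc : ℝ) ^ (2 * (d + 1))) (unitK (sfStep Lc j) (smStep d Lc j) (G j)) Lc) j (X + Y) = (fun j => lin4 (cE₂ * (Lc : ℝ) ^ (2 * (d + 1))) (unitK (sfStep Lc j) (smStep d Lc j) (G j)) Lc) j X + (fun j => lin4 (cE₂ * (Lc : ℝ) ^ (2 * (d + 1))) (unitK (sfStep Lc j) (smStep d Lc j) (G j)) Lc) j Y := fun j X Y hX hY => by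
    obtain ⟨C, δ, hδ, h⟩ := hGu j
    exact lin4_add_of_bdd₄ h hδ _ Lc hX hY
  -- the deviation's affine recursion
  have hbg : ∀ j, ∃ B : ℝ, ∀ κ u κ' u' x z a b, |(((lin4 (cE₂ * (Lc : ℝ) ^ (2 * (d + 1))) (unitK (sfStep Lc j) (smStep d Lc j) (G j)) Lc
            (unitS₂ (sfStep Lc j) (smStep d Lc j) (T2RecOf d Lc K S M cE₂ cB Tc vh₂S mixFF j)) -
          lin4 (cE₂ * (Lc : ℝ) ^ (2 * (d + 1))) (unitK (sfStep Lc j) (smStep d Lc j) (K j)) Lc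
            (unitS₂ (sfStep Lc j) (smStep d Lc j) (T2RecOf d Lc K S M cE₂ cB Tc vh₂S mixFF j))) +
        ((fun κ u κ' u' => (cE₂ * (Lc : ℝ) ^ (2 * (d + 1))) • mmRead Lc (K3OfK (unitK (sfStep Lc j) (smStep d Lc j) (G j)) Lc
            (unitS (sfStep Lc j) (smStep d Lc j) (S j)) (unitM (sfStep Lc j) (smStep d Lc j) (M j))
            (W2SymOfK (unitK (sfStep Lc j) (smStep d Lc j) (G j)) Lc (unitS (sfStep Lc j) (smStep d Lc j) (S j))
              (unitM (sfStep Lc j) (smStep d Lc j) (M j)) 0 (unitM₂ (sfStep Lc j) (smStep d Lc j) (M2Of d Lc mixFF j))) κ u κ' u')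
          + cB • vh₂S κ u κ' u') -
         (fun κ u κ' u' => (cE₂ * (Lc : ℝ) ^ (2 * (d + 1))) • mmRead Lc (K3OfK (unitK (sfStep Lc j) (smStep d Lc j) (K j)) Lc
            (unitS (sfStep Lc j) (smStep d Lc j) (S j)) (unitM (sfStep Lc j) (smStep d Lc j) (M j))
            (W2SymOfK (unitK (sfStep Lc j) (smStep d Lc j) (K j)) Lc (unitS (sfStep Lc j) (smStep d Lc j) (S j))
              (unitM (sfStep Lc j) (smStep d Lc j) (M j)) 0 (unitM₂ (sfStep Lc j) (smStep d Lc j) (M2Of d Lc mixFF j))) κ u κ' u')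
          + cB • vh₂S κ u κ' u')))) κ u κ' u' x z a b| ≤ B := fun j => by
    obtain ⟨C, δ, hδ, h⟩ := hGu j
    obtain ⟨C', δ', hδ', h'⟩ := hKu j
    exact bdd₄_add (bdd₄_sub (lin4_bdd h hδ _ Lc (hbK j)) (lin4_bdd h' hδ' _ Lc (hbK j))) (bdd₄_sub (hsG j) (hsK j))
  have hrecD := fun j => unitS₂_T2RecOf_dev_succ_of_letters G K S M cE₂ cB Tc vh₂S mixFF hLc hBff hBmm hG hK hS hM hB hmix j
  have h0 : (unitS₂ (sfStep Lc 0) (smStep d Lc 0) (T2RecOf d Lc G S M cE₂ cB Tc vh₂S mixFF 0)) - (unitS₂ (sfStep Lc 0) (smStep d Lc 0) (T2RecOf d Lc K S M cE₂ cB Tc vh₂S mixFF 0)) = 0 := by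
    rw [T2RecOf_zero_level, T2RecOf_zero_level, sub_self]
  have hx := eq_transport_add_sum (A := (fun j => lin4 (cE₂ * (Lc : ℝ) ^ (2 * (d + 1))) (unitK (sfStep Lc j) (smStep d Lc j) (G j)) Lc))
    (P := fun X : BiTab d => ∃ B : ℝ, ∀ κ u κ' u' x z a b, |X κ u κ' u' x z a b| ≤ B)
    (x := fun n => (unitS₂ (sfStep Lc n) (smStep d Lc n) (T2RecOf d Lc G S M cE₂ cB Tc vh₂S mixFF n)) - (unitS₂ (sfStep Lc n) (smStep d Lc n) (T2RecOf d Lc K S M cE₂ cB Tc vh₂S mixFF n)))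
    (b := fun i => ((lin4 (cE₂ * (Lc : ℝ) ^ (2 * (d + 1))) (unitK (sfStep Lc i) (smStep d Lc i) (G i)) Lc
            (unitS₂ (sfStep Lc i) (smStep d Lc i) (T2RecOf d Lc K S M cE₂ cB Tc vh₂S mixFF i)) -
          lin4 (cE₂ * (Lc : ℝ) ^ (2 * (d + 1))) (unitK (sfStep Lc i) (smStep d Lc i) (K i)) Lc
            (unitS₂ (sfStep Lc i) (smStep d Lc i) (T2RecOf d Lc K S M cE₂ cB Tc vh₂S mixFF i))) +
        ((fun κ u κ' u' => (cE₂ * (Lc : ℝ) ^ (2 * (d + 1))) • mmRead Lc (K3OfK (unitK (sfStep Lc i) (smStep d Lc i) (G i)) Lc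
            (unitS (sfStep Lc i) (smStep d Lc i) (S i)) (unitM (sfStep Lc i) (smStep d Lc i) (M i))
            (W2SymOfK (unitK (sfStep Lc i) (smStep d Lc i) (G i)) Lc (unitS (sfStep Lc i) (smStep d Lc i) (S i))
              (unitM (sfStep Lc i) (smStep d Lc i) (M i)) 0 (unitM₂ (sfStep Lc i) (smStep d Lc i) (M2Of d Lc mixFF i))) κ u κ' u')
          + cB • vh₂S κ u κ' u') -
         (fun κ u κ' u' => (cE₂ * (Lc : ℝ) ^ (2 * (d + 1))) • mmRead Lc (K3OfK (unitK (sfStep Lc i) (smStep d Lc i) (K i)) Lc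
            (unitS (sfStep Lc i) (smStep d Lc i) (S i)) (unitM (sfStep Lc i) (smStep d Lc i) (M i))
            (W2SymOfK (unitK (sfStep Lc i) (smStep d Lc i) (K i)) Lc (unitS (sfStep Lc i) (smStep d Lc i) (S i))
              (unitM (sfStep Lc i) (smStep d Lc i) (M i)) 0 (unitM₂ (sfStep Lc i) (smStep d Lc i) (M2Of d Lc mixFF i))) κ u κ' u')
          + cB • vh₂S κ u κ' u'))))
    bdd₄_zero (fun _ _ => bdd₄_add) hAP hAadd (by simpa using bdd₄_sub (hbG 0) (hbK 0)) hbg hrecD n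
  simp only [h0, transport_map_zero (A := (fun j => lin4 (cE₂ * (Lc : ℝ) ^ (2 * (d + 1))) (unitK (sfStep Lc j) (smStep d Lc j) (G j)) Lc)) (P := fun X : BiTab d => ∃ B : ℝ, ∀ κ u κ' u' x z a b, |X κ u κ' u' x z a b| ≤ B)
    bdd₄_zero hAadd, zero_add] at hx
  rw [← hx]
  abel

end Slotted

/-! ## §3 The comb instance (generic `d`, in-block root): dressed comb tower vs the undressed-kernel comb-slot tower -/

section Comb

variable {d : ℕ} {Lc : ℕ} [NeZero Lc] {r : Fin (d + 1) → ℕ}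

/-- NOT IN PRINT; OUR BOOKKEEPING ([folklore] §2 at `G_j := coDressKBmAt ρ Lc (KInvStep Lc j)`, `K_j := KInvStep Lc j`, comb sources, through an2's bridge `T2RecOf_comb`;
letters discharged: asym1's `decays_coDressKBmAt_KInvStep`, `OneStepKernelFamily.decays_KInvStep`, an2's `locStencil_SpureRecAt` ∕ `vertexFamily_M1At`, an1's
`hmix_an1`).  **THE COMB T₂ TOWER AS THE UNDRESSED-KERNEL COMB-SLOT TOWER PLUS DRESSED-TRANSPORTED FORCINGS**: for every in-block root, every `cE cVH cΛ cE₂ cB Tc`,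
every off-diagonal `LocStencil₂` border, `T̃_n = T_n + Σ_{i<n} 𝒯^E(i+1, n−1−i) g′_i` with `g′_i = (𝒜^E_i − 𝒜^B_i) T_i + (b̃_i − b_i)` DISPLAYED. -/
theorem unitS₂_T2RecAt_dev_eq_sum (hLc : 1 ≤ Lc) (hr : r ∈ box (d + 1) Lc) (cE cVH cΛ cE₂ cB : ℝ) (Tc : Fin 4 → Fin 4 → Fin 4 → Fin 4 → ℝ)
    {vh₂S : BiTab d}
    (hBff : ∀ κ u κ' u' x z (α β : Fin (d + 1)), vh₂S κ u κ' u' x z (Sum.inl α) (Sum.inl β) = 0)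
    (hBmm : ∀ κ u κ' u' x z (μ ν : Fin (d + 1)), vh₂S κ u κ' u' x z (Sum.inr μ) (Sum.inr ν) = 0)
    (hB : ∃ C δ : ℝ, 0 < δ ∧ LocStencil₂ vh₂S C δ) (n : ℕ) :
    (unitS₂ (sfStep Lc n) (smStep d Lc n) (T2RecAt d Lc (toSite r) cE cVH cΛ cE₂ cB Tc vh₂S (mixFFAt (toSite r) Lc) n)) =
      (unitS₂ (sfStep Lc n) (smStep d Lc n) (T2RecOf d Lc (fun j => KInvStep (d := d) Lc j) (SpureRecAt d Lc (toSite r) cE cVH cΛ) (M1At d Lc (toSite r) cΛ) cE₂ cB Tc vh₂S (mixFFAt (toSite r) Lc) n)) +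
      ∑ i ∈ Finset.range n, transport (fun j => lin4 (cE₂ * (Lc : ℝ) ^ (2 * (d + 1))) (unitK (sfStep Lc j) (smStep d Lc j) (coDressKBmAt (toSite r) Lc (KInvStep (d := d) Lc j))) Lc) (i + 1) (n - 1 - i)
        (((lin4 (cE₂ * (Lc : ℝ) ^ (2 * (d + 1))) (unitK (sfStep Lc i) (smStep d Lc i) (coDressKBmAt (toSite r) Lc (KInvStep (d := d) Lc i))) Lc
            (unitS₂ (sfStep Lc i) (smStep d Lc i) (T2RecOf d Lc (fun j => KInvStep (d := d) Lc j) (SpureRecAt d Lc (toSite r) cE cVH cΛ) (M1At d Lc (toSite r) cΛ) cE₂ cB Tc vh₂S (mixFFAt (toSite r) Lc) i)) -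
          lin4 (cE₂ * (Lc : ℝ) ^ (2 * (d + 1))) (unitK (sfStep Lc i) (smStep d Lc i) (KInvStep (d := d) Lc i)) Lc
            (unitS₂ (sfStep Lc i) (smStep d Lc i) (T2RecOf d Lc (fun j => KInvStep (d := d) Lc j) (SpureRecAt d Lc (toSite r) cE cVH cΛ) (M1At d Lc (toSite r) cΛ) cE₂ cB Tc vh₂S (mixFFAt (toSite r) Lc) i))) +
        ((fun κ u κ' u' => (cE₂ * (Lc : ℝ) ^ (2 * (d + 1))) • mmRead Lc (K3OfK (unitK (sfStep Lc i) (smStep d Lc i) (coDressKBmAt (toSite r) Lc (KInvStep (d := d) Lc i))) Lc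
            (unitS (sfStep Lc i) (smStep d Lc i) (SpureRecAt d Lc (toSite r) cE cVH cΛ i)) (unitM (sfStep Lc i) (smStep d Lc i) (M1At d Lc (toSite r) cΛ i))
            (W2SymOfK (unitK (sfStep Lc i) (smStep d Lc i) (coDressKBmAt (toSite r) Lc (KInvStep (d := d) Lc i))) Lc (unitS (sfStep Lc i) (smStep d Lc i) (SpureRecAt d Lc (toSite r) cE cVH cΛ i))
              (unitM (sfStep Lc i) (smStep d Lc i) (M1At d Lc (toSite r) cΛ i)) 0 (unitM₂ (sfStep Lc i) (smStep d Lc i) (M2Of d Lc (mixFFAt (toSite r) Lc) i))) κ u κ' u')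
          + cB • vh₂S κ u κ' u') -
         (fun κ u κ' u' => (cE₂ * (Lc : ℝ) ^ (2 * (d + 1))) • mmRead Lc (K3OfK (unitK (sfStep Lc i) (smStep d Lc i) (KInvStep (d := d) Lc i)) Lc
            (unitS (sfStep Lc i) (smStep d Lc i) (SpureRecAt d Lc (toSite r) cE cVH cΛ i)) (unitM (sfStep Lc i) (smStep d Lc i) (M1At d Lc (toSite r) cΛ i))
            (W2SymOfK (unitK (sfStep Lc i) (smStep d Lc i) (KInvStep (d := d) Lc i)) Lc (unitS (sfStep Lc i) (smStep d Lc i) (SpureRecAt d Lc (toSite r) cE cVH cΛ i))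
              (unitM (sfStep Lc i) (smStep d Lc i) (M1At d Lc (toSite r) cΛ i)) 0 (unitM₂ (sfStep Lc i) (smStep d Lc i) (M2Of d Lc (mixFFAt (toSite r) Lc) i))) κ u κ' u')
          + cB • vh₂S κ u κ' u')))) := by
  have h := unitS₂_T2RecOf_dev_eq_sum_of_letters (fun j => coDressKBmAt (toSite r) Lc (KInvStep (d := d) Lc j)) (fun j => KInvStep (d := d) Lc j)
    (SpureRecAt d Lc (toSite r) cE cVH cΛ) (M1At d Lc (toSite r) cΛ) cE₂ cB Tc vh₂S (mixFFAt (toSite r) Lc) hLc hBff hBmm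
    (fun j => decays_coDressKBmAt_KInvStep (d := d) hr j) (fun j => decays_KInvStep (d := d) (Lc := Lc) j)
    (fun j => locStencil_SpureRecAt hLc hr cE cVH cΛ j) (fun j => ⟨_, 1, one_pos, vertexFamily_M1At hLc hr cΛ j zero_le_one⟩) hB (hmix_an1 hLc hr) n
  simp only [T2RecOf_comb] at h
  exact h

/-! ## §4 The (R-DEV) END: «T2Shape» of the comb tower from four displayed rows -/

/-- NOT IN PRINT; OUR PROOF ATTEMPT ([folklore] §1 ∘ §3).  **«T2Shape» OF an2's COMB T₂ TOWER FROM (U) ∧ (G′) ∧ (Z′) ∧ (F3ᴱ-irr)** (generic `d`, `Lc ≥ 1`, every in-block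
root `r`, every `cE cVH cΛ cE₂ cB Tc`, every off-diagonal `LocStencil₂` border; `Zfree`, `mom` ABSTRACT — the class on which the DRESSED transport is irrelevant is NOT fixed
here (see the module docstring: `ZfreeSym` alone is not expected to be it)): if (U) the UNDRESSED-KERNEL comb-slot tower `T_n = unitS₂_n (T2RecOf d Lc (KInvStep Lc ·) (SpureRecAt ρ …) (M1At ρ cΛ) … n)` is uniformly
`LocStencil₂`, (G′) the forcings `g′_j` are uniformly `LocStencil₂` with (Z′) `Zfree (g′_j)` and `mom (g′_j) ≤ Cg`, and (F3ᴱ-irr) the DRESSED transport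
`transport (j ↦ lin4 (cE₂·Lc^{2(d+1)}) G̃_j Lc)` is irrelevant on such tables, then `∃ C₂′ δ₂′, 0 < δ₂′ ∧ ∀ n, LocStencil₂ T̃_n C₂′ δ₂′` — the «T2Shape» binder `hT₂` of
p2's `WrecAtSlotRows` ∕ `WrecAtSlotRowsFinal` at `d = 3`.  CONDITIONAL on the four rows (displayed). -/
theorem t2Shape_T2RecAt_of_dev_rows (hLc : 1 ≤ Lc) (hr : r ∈ box (d + 1) Lc) (cE cVH cΛ cE₂ cB : ℝ) (Tc : Fin 4 → Fin 4 → Fin 4 → Fin 4 → ℝ)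
    {vh₂S : BiTab d}
    (hBff : ∀ κ u κ' u' x z (α β : Fin (d + 1)), vh₂S κ u κ' u' x z (Sum.inl α) (Sum.inl β) = 0)
    (hBmm : ∀ κ u κ' u' x z (μ ν : Fin (d + 1)), vh₂S κ u κ' u' x z (Sum.inr μ) (Sum.inr ν) = 0)
    (hB : ∃ C δ : ℝ, 0 < δ ∧ LocStencil₂ vh₂S C δ) (Zfree : BiTab d → Prop) (mom : BiTab d → ℝ)
    {C₂ δ₂ Cg δg CE ρ δE : ℝ} (hCE : 0 ≤ CE) (hρ0 : 0 ≤ ρ) (hρ1 : ρ < 1)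
    (hT : ∀ n, LocStencil₂ (unitS₂ (sfStep Lc n) (smStep d Lc n) (T2RecOf d Lc (fun j => KInvStep (d := d) Lc j) (SpureRecAt d Lc (toSite r) cE cVH cΛ) (M1At d Lc (toSite r) cΛ) cE₂ cB Tc vh₂S (mixFFAt (toSite r) Lc) n)) C₂ δ₂) (hδ₂ : 0 < δ₂)
    (hg : ∀ m : ℕ, LocStencil₂ (((lin4 (cE₂ * (Lc : ℝ) ^ (2 * (d + 1))) (unitK (sfStep Lc m) (smStep d Lc m) (coDressKBmAt (toSite r) Lc (KInvStep (d := d) Lc m))) Lc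
            (unitS₂ (sfStep Lc m) (smStep d Lc m) (T2RecOf d Lc (fun j => KInvStep (d := d) Lc j) (SpureRecAt d Lc (toSite r) cE cVH cΛ) (M1At d Lc (toSite r) cΛ) cE₂ cB Tc vh₂S (mixFFAt (toSite r) Lc) m)) -
          lin4 (cE₂ * (Lc : ℝ) ^ (2 * (d + 1))) (unitK (sfStep Lc m) (smStep d Lc m) (KInvStep (d := d) Lc m)) Lc
            (unitS₂ (sfStep Lc m) (smStep d Lc m) (T2RecOf d Lc (fun j => KInvStep (d := d) Lc j) (SpureRecAt d Lc (toSite r) cE cVH cΛ) (M1At d Lc (toSite r) cΛ) cE₂ cB Tc vh₂S (mixFFAt (toSite r) Lc) m))) +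
        ((fun κ u κ' u' => (cE₂ * (Lc : ℝ) ^ (2 * (d + 1))) • mmRead Lc (K3OfK (unitK (sfStep Lc m) (smStep d Lc m) (coDressKBmAt (toSite r) Lc (KInvStep (d := d) Lc m))) Lc
            (unitS (sfStep Lc m) (smStep d Lc m) (SpureRecAt d Lc (toSite r) cE cVH cΛ m)) (unitM (sfStep Lc m) (smStep d Lc m) (M1At d Lc (toSite r) cΛ m))
            (W2SymOfK (unitK (sfStep Lc m) (smStep d Lc m) (coDressKBmAt (toSite r) Lc (KInvStep (d := d) Lc m))) Lc (unitS (sfStep Lc m) (smStep d Lc m) (SpureRecAt d Lc (toSite r) cE cVH cΛ m))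
              (unitM (sfStep Lc m) (smStep d Lc m) (M1At d Lc (toSite r) cΛ m)) 0 (unitM₂ (sfStep Lc m) (smStep d Lc m) (M2Of d Lc (mixFFAt (toSite r) Lc) m))) κ u κ' u')
          + cB • vh₂S κ u κ' u') -
         (fun κ u κ' u' => (cE₂ * (Lc : ℝ) ^ (2 * (d + 1))) • mmRead Lc (K3OfK (unitK (sfStep Lc m) (smStep d Lc m) (KInvStep (d := d) Lc m)) Lc
            (unitS (sfStep Lc m) (smStep d Lc m) (SpureRecAt d Lc (toSite r) cE cVH cΛ m)) (unitM (sfStep Lc m) (smStep d Lc m) (M1At d Lc (toSite r) cΛ m))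
            (W2SymOfK (unitK (sfStep Lc m) (smStep d Lc m) (KInvStep (d := d) Lc m)) Lc (unitS (sfStep Lc m) (smStep d Lc m) (SpureRecAt d Lc (toSite r) cE cVH cΛ m))
              (unitM (sfStep Lc m) (smStep d Lc m) (M1At d Lc (toSite r) cΛ m)) 0 (unitM₂ (sfStep Lc m) (smStep d Lc m) (M2Of d Lc (mixFFAt (toSite r) Lc) m))) κ u κ' u')
          + cB • vh₂S κ u κ' u')))) Cg δg)
    (hZg : ∀ m : ℕ, Zfree (((lin4 (cE₂ * (Lc : ℝ) ^ (2 * (d + 1))) (unitK (sfStep Lc m) (smStep d Lc m) (coDressKBmAt (toSite r) Lc (KInvStep (d := d) Lc m))) Lc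
            (unitS₂ (sfStep Lc m) (smStep d Lc m) (T2RecOf d Lc (fun j => KInvStep (d := d) Lc j) (SpureRecAt d Lc (toSite r) cE cVH cΛ) (M1At d Lc (toSite r) cΛ) cE₂ cB Tc vh₂S (mixFFAt (toSite r) Lc) m)) -
          lin4 (cE₂ * (Lc : ℝ) ^ (2 * (d + 1))) (unitK (sfStep Lc m) (smStep d Lc m) (KInvStep (d := d) Lc m)) Lc
            (unitS₂ (sfStep Lc m) (smStep d Lc m) (T2RecOf d Lc (fun j => KInvStep (d := d) Lc j) (SpureRecAt d Lc (toSite r) cE cVH cΛ) (M1At d Lc (toSite r) cΛ) cE₂ cB Tc vh₂S (mixFFAt (toSite r) Lc) m))) +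
        ((fun κ u κ' u' => (cE₂ * (Lc : ℝ) ^ (2 * (d + 1))) • mmRead Lc (K3OfK (unitK (sfStep Lc m) (smStep d Lc m) (coDressKBmAt (toSite r) Lc (KInvStep (d := d) Lc m))) Lc
            (unitS (sfStep Lc m) (smStep d Lc m) (SpureRecAt d Lc (toSite r) cE cVH cΛ m)) (unitM (sfStep Lc m) (smStep d Lc m) (M1At d Lc (toSite r) cΛ m))
            (W2SymOfK (unitK (sfStep Lc m) (smStep d Lc m) (coDressKBmAt (toSite r) Lc (KInvStep (d := d) Lc m))) Lc (unitS (sfStep Lc m) (smStep d Lc m) (SpureRecAt d Lc (toSite r) cE cVH cΛ m))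
              (unitM (sfStep Lc m) (smStep d Lc m) (M1At d Lc (toSite r) cΛ m)) 0 (unitM₂ (sfStep Lc m) (smStep d Lc m) (M2Of d Lc (mixFFAt (toSite r) Lc) m))) κ u κ' u')
          + cB • vh₂S κ u κ' u') -
         (fun κ u κ' u' => (cE₂ * (Lc : ℝ) ^ (2 * (d + 1))) • mmRead Lc (K3OfK (unitK (sfStep Lc m) (smStep d Lc m) (KInvStep (d := d) Lc m)) Lc
            (unitS (sfStep Lc m) (smStep d Lc m) (SpureRecAt d Lc (toSite r) cE cVH cΛ m)) (unitM (sfStep Lc m) (smStep d Lc m) (M1At d Lc (toSite r) cΛ m))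
            (W2SymOfK (unitK (sfStep Lc m) (smStep d Lc m) (KInvStep (d := d) Lc m)) Lc (unitS (sfStep Lc m) (smStep d Lc m) (SpureRecAt d Lc (toSite r) cE cVH cΛ m))
              (unitM (sfStep Lc m) (smStep d Lc m) (M1At d Lc (toSite r) cΛ m)) 0 (unitM₂ (sfStep Lc m) (smStep d Lc m) (M2Of d Lc (mixFFAt (toSite r) Lc) m))) κ u κ' u')
          + cB • vh₂S κ u κ' u')))))
    (hmom : ∀ m : ℕ, mom (((lin4 (cE₂ * (Lc : ℝ) ^ (2 * (d + 1))) (unitK (sfStep Lc m) (smStep d Lc m) (coDressKBmAt (toSite r) Lc (KInvStep (d := d) Lc m))) Lc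
            (unitS₂ (sfStep Lc m) (smStep d Lc m) (T2RecOf d Lc (fun j => KInvStep (d := d) Lc j) (SpureRecAt d Lc (toSite r) cE cVH cΛ) (M1At d Lc (toSite r) cΛ) cE₂ cB Tc vh₂S (mixFFAt (toSite r) Lc) m)) -
          lin4 (cE₂ * (Lc : ℝ) ^ (2 * (d + 1))) (unitK (sfStep Lc m) (smStep d Lc m) (KInvStep (d := d) Lc m)) Lc
            (unitS₂ (sfStep Lc m) (smStep d Lc m) (T2RecOf d Lc (fun j => KInvStep (d := d) Lc j) (SpureRecAt d Lc (toSite r) cE cVH cΛ) (M1At d Lc (toSite r) cΛ) cE₂ cB Tc vh₂S (mixFFAt (toSite r) Lc) m))) +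
        ((fun κ u κ' u' => (cE₂ * (Lc : ℝ) ^ (2 * (d + 1))) • mmRead Lc (K3OfK (unitK (sfStep Lc m) (smStep d Lc m) (coDressKBmAt (toSite r) Lc (KInvStep (d := d) Lc m))) Lc
            (unitS (sfStep Lc m) (smStep d Lc m) (SpureRecAt d Lc (toSite r) cE cVH cΛ m)) (unitM (sfStep Lc m) (smStep d Lc m) (M1At d Lc (toSite r) cΛ m))
            (W2SymOfK (unitK (sfStep Lc m) (smStep d Lc m) (coDressKBmAt (toSite r) Lc (KInvStep (d := d) Lc m))) Lc (unitS (sfStep Lc m) (smStep d Lc m) (SpureRecAt d Lc (toSite r) cE cVH cΛ m))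
              (unitM (sfStep Lc m) (smStep d Lc m) (M1At d Lc (toSite r) cΛ m)) 0 (unitM₂ (sfStep Lc m) (smStep d Lc m) (M2Of d Lc (mixFFAt (toSite r) Lc) m))) κ u κ' u')
          + cB • vh₂S κ u κ' u') -
         (fun κ u κ' u' => (cE₂ * (Lc : ℝ) ^ (2 * (d + 1))) • mmRead Lc (K3OfK (unitK (sfStep Lc m) (smStep d Lc m) (KInvStep (d := d) Lc m)) Lc
            (unitS (sfStep Lc m) (smStep d Lc m) (SpureRecAt d Lc (toSite r) cE cVH cΛ m)) (unitM (sfStep Lc m) (smStep d Lc m) (M1At d Lc (toSite r) cΛ m))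
            (W2SymOfK (unitK (sfStep Lc m) (smStep d Lc m) (KInvStep (d := d) Lc m)) Lc (unitS (sfStep Lc m) (smStep d Lc m) (SpureRecAt d Lc (toSite r) cE cVH cΛ m))
              (unitM (sfStep Lc m) (smStep d Lc m) (M1At d Lc (toSite r) cΛ m)) 0 (unitM₂ (sfStep Lc m) (smStep d Lc m) (M2Of d Lc (mixFFAt (toSite r) Lc) m))) κ u κ' u')
          + cB • vh₂S κ u κ' u')))) ≤ Cg)
    (hTirrE : ∀ (m k : ℕ) (X : BiTab d) (C : ℝ), 0 ≤ C → LocStencil₂ X C δg → Zfree X → mom X ≤ C →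
      LocStencil₂ (transport (fun j => lin4 (cE₂ * (Lc : ℝ) ^ (2 * (d + 1))) (unitK (sfStep Lc j) (smStep d Lc j) (coDressKBmAt (toSite r) Lc (KInvStep (d := d) Lc j))) Lc) m k X) (CE * C * ρ ^ k) δE) (hδE : 0 < δE) :
    ∃ C₂' δ₂' : ℝ, 0 < δ₂' ∧ ∀ n, LocStencil₂ (unitS₂ (sfStep Lc n) (smStep d Lc n) (T2RecAt d Lc (toSite r) cE cVH cΛ cE₂ cB Tc vh₂S (mixFFAt (toSite r) Lc) n)) C₂' δ₂' :=
  ⟨C₂ + CE * Cg * (1 - ρ)⁻¹, min δ₂ δE, lt_min hδ₂ hδE, fun n => shape_of_dev_rows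
    (fun n => (unitS₂ (sfStep Lc n) (smStep d Lc n) (T2RecOf d Lc (fun j => KInvStep (d := d) Lc j) (SpureRecAt d Lc (toSite r) cE cVH cΛ) (M1At d Lc (toSite r) cΛ) cE₂ cB Tc vh₂S (mixFFAt (toSite r) Lc) n)))
    (fun n => (unitS₂ (sfStep Lc n) (smStep d Lc n) (T2RecAt d Lc (toSite r) cE cVH cΛ cE₂ cB Tc vh₂S (mixFFAt (toSite r) Lc) n)))
    (fun m => ((lin4 (cE₂ * (Lc : ℝ) ^ (2 * (d + 1))) (unitK (sfStep Lc m) (smStep d Lc m) (coDressKBmAt (toSite r) Lc (KInvStep (d := d) Lc m))) Lc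
            (unitS₂ (sfStep Lc m) (smStep d Lc m) (T2RecOf d Lc (fun j => KInvStep (d := d) Lc j) (SpureRecAt d Lc (toSite r) cE cVH cΛ) (M1At d Lc (toSite r) cΛ) cE₂ cB Tc vh₂S (mixFFAt (toSite r) Lc) m)) -
          lin4 (cE₂ * (Lc : ℝ) ^ (2 * (d + 1))) (unitK (sfStep Lc m) (smStep d Lc m) (KInvStep (d := d) Lc m)) Lc
            (unitS₂ (sfStep Lc m) (smStep d Lc m) (T2RecOf d Lc (fun j => KInvStep (d := d) Lc j) (SpureRecAt d Lc (toSite r) cE cVH cΛ) (M1At d Lc (toSite r) cΛ) cE₂ cB Tc vh₂S (mixFFAt (toSite r) Lc) m))) +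
        ((fun κ u κ' u' => (cE₂ * (Lc : ℝ) ^ (2 * (d + 1))) • mmRead Lc (K3OfK (unitK (sfStep Lc m) (smStep d Lc m) (coDressKBmAt (toSite r) Lc (KInvStep (d := d) Lc m))) Lc
            (unitS (sfStep Lc m) (smStep d Lc m) (SpureRecAt d Lc (toSite r) cE cVH cΛ m)) (unitM (sfStep Lc m) (smStep d Lc m) (M1At d Lc (toSite r) cΛ m))
            (W2SymOfK (unitK (sfStep Lc m) (smStep d Lc m) (coDressKBmAt (toSite r) Lc (KInvStep (d := d) Lc m))) Lc (unitS (sfStep Lc m) (smStep d Lc m) (SpureRecAt d Lc (toSite r) cE cVH cΛ m))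
              (unitM (sfStep Lc m) (smStep d Lc m) (M1At d Lc (toSite r) cΛ m)) 0 (unitM₂ (sfStep Lc m) (smStep d Lc m) (M2Of d Lc (mixFFAt (toSite r) Lc) m))) κ u κ' u')
          + cB • vh₂S κ u κ' u') -
         (fun κ u κ' u' => (cE₂ * (Lc : ℝ) ^ (2 * (d + 1))) • mmRead Lc (K3OfK (unitK (sfStep Lc m) (smStep d Lc m) (KInvStep (d := d) Lc m)) Lc
            (unitS (sfStep Lc m) (smStep d Lc m) (SpureRecAt d Lc (toSite r) cE cVH cΛ m)) (unitM (sfStep Lc m) (smStep d Lc m) (M1At d Lc (toSite r) cΛ m))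
            (W2SymOfK (unitK (sfStep Lc m) (smStep d Lc m) (KInvStep (d := d) Lc m)) Lc (unitS (sfStep Lc m) (smStep d Lc m) (SpureRecAt d Lc (toSite r) cE cVH cΛ m))
              (unitM (sfStep Lc m) (smStep d Lc m) (M1At d Lc (toSite r) cΛ m)) 0 (unitM₂ (sfStep Lc m) (smStep d Lc m) (M2Of d Lc (mixFFAt (toSite r) Lc) m))) κ u κ' u')
          + cB • vh₂S κ u κ' u'))))
    (fun j => lin4 (cE₂ * (Lc : ℝ) ^ (2 * (d + 1))) (unitK (sfStep Lc j) (smStep d Lc j) (coDressKBmAt (toSite r) Lc (KInvStep (d := d) Lc j))) Lc) Zfree mom hCE hρ0 hρ1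
    (fun n => unitS₂_T2RecAt_dev_eq_sum (d := d) hLc hr cE cVH cΛ cE₂ cB Tc hBff hBmm hB n) hT hg hZg hmom hTirrE n⟩

end Comb

end Summit.QuantumFields.BalabanUV.Beta.GAN24.T2DeviationTower

end
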